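import Summits.AnomalousDissipation.AnomalousDissipation.Theorems.SolenoidalFractalHomogenisationLagrangianStepVmodFsGridAssembly
import Summits.AnomalousDissipation.AnomalousDissipation.Theorems.SolenoidalFractalHomogenisationLagrangianStepVmodFlatBlocksP
import HarnessLib

/-!
# K1L_D (stmt-AnomalousDissipation-27980): (V_mod) flat stage — THE (fs) BLOCK OF RECORD `Bfs_textEVHP (fun σ => min (σ/2) (1/2))` IS A THEOREM
# (grid-phase family of RULING D28-9, text `…VmodFlatBlocksP` p721357; prover ad-k1loc-p3 g11, `--supports 27980 --as helper`)

The one-line bridge announced in `…VmodFsGridAssembly`: `exists_fs_blockBound_grid` (binder `(∃ j : ℕ, s = j·(M·W.period/ν))` after `t ≤ Tw`)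
feeds k3l g10's `BlockBoundP` (binder `∀ j t, let s := j·(M·W.period/ν); s < t → t ≤ Tw → …`) by `intro … j t s …; exact … s t _ hst htT ⟨j, rfl⟩ …`
(`0 ≤ s` discharged from `0 < M`, `0 < W.period`, `0 < ν`, as in `blockBoundP_of_blockBound`).
* `bfsP_of_exponent` — `Bfs_textEVHP e` for EVERY exponent map with `0 ≤ e σ ≤ min(σ/2, 1/2)` on `σ > 0`;
* **`bfsP_half : Bfs_textEVHP (fun σ => min (σ / 2) (1 / 2))`** — the (fs) input of `lossFlatWP_of_blocksEVHP` at the exponent of the texts of record.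
Inputs (all landed, `--supports 27980`): short window p714276 · period window p718162 · mean removal p715688 · row assembler p719619 · rows p719383 /
p719093 (+ `coarse_smallness` p717612) / p719722 (+ `high_label_bounds`) / floor p720047 · dispatch `fs_row_of_grid` p721639 · assembly
`exists_fs_blockBound_grid` p721880.  `sorry`-free; NOT a proof of the other three blocks, of `stub_Vmod_EHTthg`, of K1L_D or of AD; rung F-D1.A0.
-/

set_option linter.dupNamespace false

noncomputable section

namespace Summit.AnomalousDissipation.AnomalousDissipation.Theorems.SolenoidalFractalHomogenisation.LagrangianStep.VmodFlat

open Literature.Analysis Literature.Analysis.FluidPDE Literature.Analysis.FunctionSpaces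
open MeasureTheory Set Filter UnitAddTorus
open scoped ENNReal NNReal InnerProductSpace
open Summit.AnomalousDissipation.AnomalousDissipation.Theorems.SolenoidalFractalHomogenisation.LagrangianStep.CellClauseMod
open Summit.AnomalousDissipation.AnomalousDissipation.Theorems.SolenoidalFractalHomogenisation.LagrangianStep.LossCurrency

/-- **(fs) on the grid, any admissible exponent map**: `Bfs_textEVHP e` whenever `0 ≤ e σ ≤ min(σ/2, 1/2)` for every `σ > 0`. -/
theorem bfsP_of_exponent (e : ℝ → ℝ) (he0 : ∀ σ : ℝ, 0 < σ → 0 ≤ e σ) (heσ : ∀ σ : ℝ, 0 < σ → e σ ≤ σ / 2)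
    (he12 : ∀ σ : ℝ, 0 < σ → e σ ≤ 1 / 2) : Bfs_textEVHP e := by
  intro k W M hM c hc Φ lo hi Λ β σ C ν₀ K hlo _hlo1 hhi hΛ hβ hσ hC _hν₀ hν₀1 hK hV hH
  obtain ⟨C₃, hC₃, h⟩ := exists_fs_blockBound_grid W M hM hc Φ hlo hhi hΛ hβ hσ hC hν₀1 hK hV hH (he0 σ hσ) (heσ σ hσ) (he12 σ hσ)
  refine ⟨C₃, hC₃, ?_⟩
  intro ν hν n hn 𝔸 hodd hwin hΦo hΦw Tw hTw U T hU hT j t s hst htT x ζ hx hζ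
  have hs : 0 ≤ s := by
    show (0:ℝ) ≤ (j : ℝ) * (M * W.period / ν)
    exact mul_nonneg (Nat.cast_nonneg j) (div_nonneg (mul_nonneg hM.le
      (Summit.AnomalousDissipation.AnomalousDissipation.Theorems.SolenoidalFractalHomogenisation.PermissibleCarrier.period_pos W).le) hν.1.le)
  exact h ν hν n hn 𝔸 hodd hwin hΦo hΦw Tw hTw U T hU hT s t hs hst htT ⟨j, rfl⟩ x ζ hx hζ

/-- **THE (fs) BLOCK OF RECORD IS A THEOREM**: `Bfs_textEVHP (fun σ => min (σ/2) (1/2))` — the third input of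
`lossFlatWP_of_blocksEVHP` (k3l g10, p721357) at the exponent of the registered texts. -/
theorem bfsP_half : Bfs_textEVHP (fun σ => min (σ / 2) (1 / 2)) :=
  bfsP_of_exponent _ (fun σ hσ => le_min (by linarith) (by norm_num)) (fun _ _ => min_le_left _ _) (fun _ _ => min_le_right _ _)

end Summit.AnomalousDissipation.AnomalousDissipation.Theorems.SolenoidalFractalHomogenisation.LagrangianStep.VmodFlat

end
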